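import Summits.AtomisticToContinuum.Crystallization.Theses.ThreeConeCertificate
import Literature.MathematicalPhysics.StatisticalMechanics.CrystallizationLocalLimit
import Literature.MathematicalPhysics.StatisticalMechanics.CrystallizationSymmetries

/-!
# Route ThreeConeCertificate — the soft assembly lemma `DefectVanishCrystallizes`
# (item stmt-AtomisticToContinuum-0752, shared by the Crystallization routes)

`DefectVanishCrystallizes`: the hinge `BulkDefectVanish` (one periodic configuration `P` of `ℝ³`
such that, for every window radius `R` and tolerance `ε`, along every sequence of Lennard-Jones
ground states all but `o(N)` particles `i` admit a linear isometry `A` with the particles in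
`B_R(x_i)` two-way `ε`-matched to `x_i + A(P ∩ B_R)`) together with the uniform minimal distance
of Lennard-Jones ground states (`LennardJonesMinimalDistance`, Xue 1997 / Blanc–Lewin 2015 §2.2,
PROVED in the tree) implies `IsCrystallizing lennardJones 3` (Blanc–Lewin 2015, §2.1 (15)–(17)).

Proof (soft; stated for a general potential `V`, dimension `d` and periodic `P` as
`isCrystallizing_of_bulkDefectVanish`). Given ground states `x^N`:
1. for every scale `k` (radius `k+1`, tolerance `1/(k+1)`) the density of bad particles tends to
   `0`, so eventually in `N` there is a good particle (`exists_good_of_card_div_lt`);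
   `Filter.extraction_forall_of_eventually` picks `N_k = φ k ↑` and good particles `i_k` with
   charts `A_k`; recentre, `τ_k = -x_{i_k}`, `y_k = x^{N_k} + τ_k`;
2. `exists_subseq_linearIsometry_tendsto`: the charts, viewed in the proper space
   `ℝᵈ →L[ℝ] ℝᵈ` where they have norm `≤ 1`, have a subsequence `A_{ψ l} → B` in operator norm,
   and `B` is again a linear isometry (norm preservation passes to the limit), upgraded to a
   `LinearIsometryEquiv` (equal finite dimension);
3. `eventually_matched_isometryImage`: along `ψ` the recentred configurations are, for every
   `R`, `ε > 0`, eventually two-way `ε`-matched on `‖·‖ ≤ R` with the rotated periodic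
   configuration `P.isometryImage B` (`CrystallizationSymmetries.lean`);
4. the uniform minimal distance makes the matching a local bijection near the support of a test
   function: `PeriodicConfiguration.tendsto_sum_of_eventually_near'`
   (`CrystallizationLocalLimit.lean`) gives the local convergence with multiplicity `m ≡ 1`.
All `[folklore]` (Blanc–Lewin 2015, §2.2, for the role of the minimal distance).
-/

noncomputable section

namespace Summit.AtomisticToContinuum.Crystallization.Theorems.ThreeConeCertificateDefectVanishCrystallizes

open Literature.MathematicalPhysics.StatisticalMechanics
open Filter Topology Metric

variable {d : ℕ}

/-- **Counting.** If fewer than half of the `N ≥ 1` indices are bad, some index is good.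
[folklore] -/
theorem exists_good_of_card_div_lt {N : ℕ} {good : Fin N → Prop} (hN : 1 ≤ N)
    (h : (Nat.card {i : Fin N // ¬ good i} : ℝ) / N < 1 / 2) : ∃ i, good i := by
  by_contra hcon
  push Not at hcon
  rw [Nat.card_congr (Equiv.subtypeUnivEquiv hcon), Nat.card_fin,
    div_self (by exact_mod_cast (by omega : N ≠ 0))] at h
  norm_num at h

/-- **Compactness of the linear isometries of `ℝᵈ` (sequential form, operator norm).** Every
sequence `A_k` of linear isometries of `ℝᵈ` has a subsequence `A_{ψ l}` converging in operator
norm to a linear isometry `B` (here bundled as a `LinearIsometryEquiv`): for every `η > 0`,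
eventually `‖A_{ψ l} v - B v‖ ≤ η ‖v‖` for all `v`. (The isometries lie in the closed unit ball
of the proper space `ℝᵈ →L[ℝ] ℝᵈ`; norm preservation passes to the limit.) [folklore] -/
theorem exists_subseq_linearIsometry_tendsto
    (A : ℕ → EuclideanSpace ℝ (Fin d) →ₗᵢ[ℝ] EuclideanSpace ℝ (Fin d)) :
    ∃ (ψ : ℕ → ℕ) (B : EuclideanSpace ℝ (Fin d) ≃ₗᵢ[ℝ] EuclideanSpace ℝ (Fin d)), StrictMono ψ ∧
      ∀ η : ℝ, 0 < η → ∀ᶠ l in atTop, ∀ v, ‖A (ψ l) v - B v‖ ≤ η * ‖v‖ := by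
  set T : ℕ → (EuclideanSpace ℝ (Fin d) →L[ℝ] EuclideanSpace ℝ (Fin d)) :=
    fun k => (A k).toContinuousLinearMap with hT
  have hTmem : ∀ k, T k ∈ closedBall (0 : EuclideanSpace ℝ (Fin d) →L[ℝ] EuclideanSpace ℝ (Fin d)) 1 :=
    fun k => mem_closedBall_zero_iff.2 (A k).norm_toContinuousLinearMap_le
  obtain ⟨L, -, ψ, hψ, hlim⟩ := (isCompact_closedBall _ _).tendsto_subseq hTmem
  have hev : ∀ v, Tendsto (fun l => T (ψ l) v) atTop (𝓝 (L v)) := fun v =>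
    ((ContinuousLinearMap.apply ℝ (EuclideanSpace ℝ (Fin d)) v).continuous.tendsto L).comp hlim
  have hnorm : ∀ v, ‖L v‖ = ‖v‖ := fun v =>
    tendsto_nhds_unique (hev v).norm (by simp [hT])
  set B₀ : EuclideanSpace ℝ (Fin d) →ₗᵢ[ℝ] EuclideanSpace ℝ (Fin d) :=
    ⟨(L : EuclideanSpace ℝ (Fin d) →ₗ[ℝ] EuclideanSpace ℝ (Fin d)), hnorm⟩ with hB₀
  refine ⟨ψ, B₀.toLinearIsometryEquiv rfl, hψ, fun η hη => ?_⟩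
  filter_upwards [Metric.tendsto_nhds.1 hlim η hη] with l hl v
  have h1 : A (ψ l) v - B₀.toLinearIsometryEquiv rfl v = (T (ψ l) - L) v := rfl
  calc ‖A (ψ l) v - B₀.toLinearIsometryEquiv rfl v‖ = ‖(T (ψ l) - L) v‖ := by rw [h1]
    _ ≤ ‖T (ψ l) - L‖ * ‖v‖ := (T (ψ l) - L).le_opNorm v
    _ ≤ η * ‖v‖ := by
        refine mul_le_mul_of_nonneg_right ?_ (norm_nonneg _)
        rw [← dist_eq_norm]
        exact hl.le

/-- **Matching to rotated copies with converging rotations.** Let `P` be a periodic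
configuration of `ℝᵈ`, `y_k` finite configurations and `A_k` linear isometries such that at
scale `k` the configuration `y_k` is two-way `1/(k+1)`-matched with `A_k(P)` on the ball
`‖·‖ ≤ k + 1` about the origin. Then along a subsequence `ψ` (on which `A_{ψ l} → B`) the
configurations `y_{ψ l}` are, for every `R` and `ε > 0`, eventually two-way `ε`-matched on
`‖·‖ ≤ R` with the single periodic configuration `B(P) = P.isometryImage B`. [folklore] -/
theorem eventually_matched_isometryImage (P : PeriodicConfiguration d) {n : ℕ → ℕ}
    (y : (k : ℕ) → Fin (n k) → EuclideanSpace ℝ (Fin d))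
    (A : ℕ → EuclideanSpace ℝ (Fin d) →ₗᵢ[ℝ] EuclideanSpace ℝ (Fin d))
    (hy : ∀ k : ℕ,
      (∀ p ∈ P.points, ‖p‖ ≤ (k : ℝ) + 1 → ∃ j, dist (y k j) (A k p) ≤ 1 / ((k : ℝ) + 1)) ∧
      (∀ j, ‖y k j‖ ≤ (k : ℝ) + 1 → ∃ p ∈ P.points, dist (y k j) (A k p) ≤ 1 / ((k : ℝ) + 1))) :
    ∃ (ψ : ℕ → ℕ) (B : EuclideanSpace ℝ (Fin d) ≃ₗᵢ[ℝ] EuclideanSpace ℝ (Fin d)), StrictMono ψ ∧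
      ∀ R ε : ℝ, 0 < ε → ∀ᶠ l in atTop,
        (∀ s ∈ (P.isometryImage B).points, ‖s‖ ≤ R → ∃ j, dist (y (ψ l) j) s ≤ ε) ∧
        (∀ j, ‖y (ψ l) j‖ ≤ R → ∃ s ∈ (P.isometryImage B).points, dist (y (ψ l) j) s ≤ ε) := by
  obtain ⟨ψ, B, hψ, hB⟩ := exists_subseq_linearIsometry_tendsto A
  refine ⟨ψ, B, hψ, fun R ε hε => ?_⟩
  set R' : ℝ := max R 0 + 1 with hR'
  have hR'0 : 0 < R' := by rw [hR']; positivity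
  have hRR' : R ≤ R' := by rw [hR']; linarith [le_max_left R 0]
  have h0R' : (1 : ℝ) ≤ R' := by rw [hR']; linarith [le_max_right R 0]
  filter_upwards [hB (ε / (2 * R')) (by positivity), eventually_ge_atTop ⌈max R' (2 / ε)⌉₊]
    with l hl hl'
  have hk : (⌈max R' (2 / ε)⌉₊ : ℝ) ≤ (ψ l : ℝ) := by exact_mod_cast hl'.trans hψ.le_apply
  have hk' : max R' (2 / ε) ≤ (ψ l : ℝ) := (Nat.le_ceil _).trans hk
  have hkR : R' ≤ (ψ l : ℝ) + 1 := by linarith [le_max_left R' (2 / ε)]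
  have hkε : 1 / ((ψ l : ℝ) + 1) ≤ ε / 2 := by
    have h2 : 2 / ε ≤ (ψ l : ℝ) := (le_max_right _ _).trans hk'
    rw [div_le_iff₀ hε] at h2
    rw [div_le_div_iff₀ (by positivity) (by norm_num)]
    nlinarith
  have hηR' : ε / (2 * R') * R' = ε / 2 := by field_simp
  obtain ⟨h1, h2⟩ := hy (ψ l)
  constructor
  · intro s hs hsR
    have hp : B.symm s ∈ P.points := (P.mem_points_isometryImage B).1 hs
    have hpn : ‖B.symm s‖ ≤ (ψ l : ℝ) + 1 := by
      rw [B.symm.norm_map]; exact hsR.trans (hRR'.trans hkR)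
    obtain ⟨j, hj⟩ := h1 (B.symm s) hp hpn
    refine ⟨j, ?_⟩
    have hAB : ‖A (ψ l) (B.symm s) - s‖ ≤ ε / 2 := by
      have h := hl (B.symm s)
      rw [B.apply_symm_apply, B.symm.norm_map] at h
      refine h.trans ?_
      calc ε / (2 * R') * ‖s‖ ≤ ε / (2 * R') * R' := by gcongr; exact hsR.trans hRR'
        _ = ε / 2 := hηR'
    calc dist (y (ψ l) j) s
        ≤ dist (y (ψ l) j) (A (ψ l) (B.symm s)) + dist (A (ψ l) (B.symm s)) s := dist_triangle _ _ _
      _ ≤ 1 / ((ψ l : ℝ) + 1) + ε / 2 := add_le_add hj (by rw [dist_eq_norm]; exact hAB)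
      _ ≤ ε := by linarith
  · intro j hj
    obtain ⟨p, hp, hjp⟩ := h2 j (hj.trans (hRR'.trans hkR))
    refine ⟨B p, (P.mem_points_isometryImage B).2 (by rw [B.symm_apply_apply]; exact hp), ?_⟩
    have hpn : ‖p‖ ≤ R' := by
      have h3 : ‖A (ψ l) p‖ ≤ ‖y (ψ l) j‖ + ‖y (ψ l) j - A (ψ l) p‖ :=
        calc ‖A (ψ l) p‖ = ‖y (ψ l) j - (y (ψ l) j - A (ψ l) p)‖ := by rw [sub_sub_cancel]
          _ ≤ ‖y (ψ l) j‖ + ‖y (ψ l) j - A (ψ l) p‖ := norm_sub_le _ _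
      rw [LinearIsometry.norm_map, ← dist_eq_norm] at h3
      have h1' : 1 / ((ψ l : ℝ) + 1) ≤ 1 := by
        rw [div_le_one (by positivity)]; linarith [(Nat.cast_nonneg (ψ l) : (0 : ℝ) ≤ _)]
      rw [hR']
      linarith [le_max_left R 0]
    have hAB : ‖A (ψ l) p - B p‖ ≤ ε / 2 :=
      calc ‖A (ψ l) p - B p‖ ≤ ε / (2 * R') * ‖p‖ := hl p
        _ ≤ ε / (2 * R') * R' := by gcongr
        _ = ε / 2 := hηR'
    calc dist (y (ψ l) j) (B p)
        ≤ dist (y (ψ l) j) (A (ψ l) p) + dist (A (ψ l) p) (B p) := dist_triangle _ _ _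
      _ ≤ 1 / ((ψ l : ℝ) + 1) + ε / 2 := add_le_add hjp (by rw [dist_eq_norm]; exact hAB)
      _ ≤ ε := by linarith

/-- **Soft assembly (general potential, dimension and reference configuration).** If, for one
periodic configuration `P` of `ℝᵈ`, every window radius `R > 0` and tolerance `ε > 0`, along
every sequence of ground states of `V` the density of particles `i` admitting NO linear
isometry `A` with the particles in `B_R(x_i)` two-way `ε`-matched to `x_i + A(P ∩ B̄_R)` tends to
`0`, and the ground states of `V` have a uniform minimal distance `δ > 0`, then `V`
crystallizes in dimension `d` in the sense of Blanc–Lewin (`IsCrystallizing V d`): the limit is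
a rotated copy `P.isometryImage B` of `P`, with multiplicity `m ≡ 1`. [folklore] -/
theorem isCrystallizing_of_bulkDefectVanish {V : ℝ → ℝ} (P : PeriodicConfiguration d)
    (hBDV : ∀ R ε : ℝ, 0 < R → 0 < ε → ∀ x : (N : ℕ) → (Fin N → EuclideanSpace ℝ (Fin d)),
      (∀ N, IsGroundState V (x N)) →
      Tendsto (fun N : ℕ => (Nat.card {i : Fin N // ¬ ∃ A : EuclideanSpace ℝ (Fin d) →ₗᵢ[ℝ]
        EuclideanSpace ℝ (Fin d),
        (∀ p ∈ P.points, ‖p‖ ≤ R → ∃ j : Fin N, dist (x N j) (x N i + A p) ≤ ε) ∧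
        (∀ j : Fin N, dist (x N j) (x N i) ≤ R → ∃ p ∈ P.points, dist (x N j) (x N i + A p) ≤ ε)}
          : ℝ) / N) atTop (𝓝 0))
    {δ : ℝ} (hδ : 0 < δ)
    (hsep : ∀ (N : ℕ) (x : Fin N → EuclideanSpace ℝ (Fin d)), IsGroundState V x →
      ∀ i j, i ≠ j → δ ≤ dist (x i) (x j)) :
    IsCrystallizing V d := by
  intro x hx
  -- Step 1: at every scale `k`, eventually in `N`, a good particle with its chart
  have hev : ∀ k : ℕ, ∀ᶠ N in atTop, ∃ (i : Fin N) (A : EuclideanSpace ℝ (Fin d) →ₗᵢ[ℝ]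
      EuclideanSpace ℝ (Fin d)),
      (∀ p ∈ P.points, ‖p‖ ≤ (k : ℝ) + 1 →
        ∃ j : Fin N, dist (x N j) (x N i + A p) ≤ 1 / ((k : ℝ) + 1)) ∧
      (∀ j : Fin N, dist (x N j) (x N i) ≤ (k : ℝ) + 1 →
        ∃ p ∈ P.points, dist (x N j) (x N i + A p) ≤ 1 / ((k : ℝ) + 1)) := by
    intro k
    have ht := hBDV ((k : ℝ) + 1) (1 / ((k : ℝ) + 1)) (by positivity) (by positivity) x hx
    filter_upwards [ht.eventually (gt_mem_nhds (show (0 : ℝ) < 1 / 2 by norm_num)),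
      eventually_ge_atTop 1] with N hN hN1
    by_contra hcon
    have hall : ∀ i : Fin N, ¬ ∃ A : EuclideanSpace ℝ (Fin d) →ₗᵢ[ℝ] EuclideanSpace ℝ (Fin d),
        (∀ p ∈ P.points, ‖p‖ ≤ (k : ℝ) + 1 →
          ∃ j : Fin N, dist (x N j) (x N i + A p) ≤ 1 / ((k : ℝ) + 1)) ∧
        (∀ j : Fin N, dist (x N j) (x N i) ≤ (k : ℝ) + 1 →
          ∃ p ∈ P.points, dist (x N j) (x N i + A p) ≤ 1 / ((k : ℝ) + 1)) :=
      fun i hi => hcon ⟨i, hi⟩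
    obtain ⟨i, hi⟩ := exists_good_of_card_div_lt hN1 hN
    exact hall i hi
  -- Step 2: extract `N_k = φ k ↑`, good particles `i k`, charts `A k`; recentre
  obtain ⟨φ, hφ, hgood⟩ := extraction_forall_of_eventually hev
  choose i A hA using hgood
  set τ : ℕ → EuclideanSpace ℝ (Fin d) := fun k => -x (φ k) (i k) with hτ
  set y : (k : ℕ) → Fin (φ k) → EuclideanSpace ℝ (Fin d) := fun k j => x (φ k) j + τ k with hy
  have hdist : ∀ k j q, dist (y k j) q = dist (x (φ k) j) (x (φ k) (i k) + q) := fun k j q => by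
    show dist (x (φ k) j + -x (φ k) (i k)) q = _
    rw [← dist_add_right (x (φ k) j + -x (φ k) (i k)) q (x (φ k) (i k)), neg_add_cancel_right,
      add_comm q]
  have hnorm : ∀ k j, ‖y k j‖ = dist (x (φ k) j) (x (φ k) (i k)) := fun k j => by
    show ‖x (φ k) j + -x (φ k) (i k)‖ = _
    rw [← sub_eq_add_neg, dist_eq_norm]
  have hy' : ∀ k : ℕ,
      (∀ p ∈ P.points, ‖p‖ ≤ (k : ℝ) + 1 → ∃ j, dist (y k j) (A k p) ≤ 1 / ((k : ℝ) + 1)) ∧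
      (∀ j, ‖y k j‖ ≤ (k : ℝ) + 1 → ∃ p ∈ P.points, dist (y k j) (A k p) ≤ 1 / ((k : ℝ) + 1)) := by
    intro k
    obtain ⟨h1, h2⟩ := hA k
    refine ⟨fun p hp hpk => ?_, fun j hj => ?_⟩
    · obtain ⟨j, hj⟩ := h1 p hp hpk
      exact ⟨j, by rw [hdist]; exact hj⟩
    · obtain ⟨p, hp, hjp⟩ := h2 j (by rw [← hnorm]; exact hj)
      exact ⟨p, hp, by rw [hdist]; exact hjp⟩
  -- Step 3: converging charts, one rotated limit configuration
  obtain ⟨ψ, B, hψ, hmatch⟩ := eventually_matched_isometryImage P y A hy'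
  -- Step 4: minimal distance + approximate matching ⇒ local convergence
  have hsep' : ∀ l (j j' : Fin (φ (ψ l))), j ≠ j' → δ ≤ dist (y (ψ l) j) (y (ψ l) j') := by
    intro l j j' hjj'
    show δ ≤ dist (x (φ (ψ l)) j + τ (ψ l)) (x (φ (ψ l)) j' + τ (ψ l))
    rw [dist_add_right]
    exact hsep _ _ (hx _) j j' hjj'
  refine ⟨φ ∘ ψ, τ ∘ ψ, P.isometryImage B, fun _ => 1, hφ.comp hψ, fun _ _ => le_rfl,
    fun _ _ _ => rfl, fun f hfc hf => ?_⟩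
  exact (P.isometryImage B).tendsto_sum_of_eventually_near' (fun l => y (ψ l)) hδ hsep' hmatch hfc hf

/-- **Item stmt-AtomisticToContinuum-0752** (`DefectVanishCrystallizes`, route ThreeConeCertificate):
`BulkDefectVanish → LennardJonesMinimalDistance → IsCrystallizing lennardJones 3` — the soft
assembly lemma, by `isCrystallizing_of_bulkDefectVanish` at `V = V_LJ`, `d = 3`. [folklore] -/
theorem defectVanishCrystallizes_proof :
    Summit.AtomisticToContinuum.Crystallization.Theses.ThreeConeCertificate.DefectVanishCrystallizes := by
  unfold Summit.AtomisticToContinuum.Crystallization.Theses.ThreeConeCertificate.DefectVanishCrystallizes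
    Summit.AtomisticToContinuum.Crystallization.Theses.ThreeConeCertificate.BulkDefectVanish
    LennardJonesMinimalDistance
  rintro ⟨P, hP⟩ ⟨δ, hδ, hsep⟩
  exact isCrystallizing_of_bulkDefectVanish P hP hδ hsep

end Summit.AtomisticToContinuum.Crystallization.Theorems.ThreeConeCertificateDefectVanishCrystallizes

end
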